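import Mathlib
import HarnessLib
import Literature.NumberTheory.LFunctions.ZetaZeros
import Literature.NumberTheory.LFunctions.ZetaFirstZeroCertificate
import Literature.NumberTheory.LFunctions.ZetaZeroTailSums
import Literature.NumberTheory.LFunctions.DirichletPolynomialMeanValue
import Literature.NumberTheory.LFunctions.DirichletPolynomialDiscreteMeanValue
import Literature.NumberTheory.LFunctions.DirichletPolynomialGallagher
import Literature.NumberTheory.LFunctions.LittlewoodOscillationInputsAverageProofs
import Literature.NumberTheory.Sieve.MatomakiRadziwillLemma11Tools

/-!
# Real Dirichlet polynomials at the zeros of `ζ`, I: low zeros and the tail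
(route EtaLeadingQuarter, item `WeakLockingLayer`, stmt-RiemannHypothesis-21792)

RH-free bookkeeping for the zero-side functional
`Z(a) = ∑'_ρ m(ρ) γ_ρ^{-2} ‖D_a(γ_ρ)‖²`, `D_a(t) = ∑_{1 ≤ k ≤ M} a_k k^{-it}` (`a_k` real),
over the non-trivial zeros `ρ = β + iγ` of `ζ` counted with multiplicity (tree:
`NicolasJExplicit.Zeros`, `SchoenfeldBound.zerosUpTo`, `ZetaZeroTails.tailInvImSq`):

* `dirPoly` and its elementary properties (`‖D(t)‖ ≤ ∑|a_k|`, `‖D(−t)‖ = ‖D(t)‖`);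
* every zero has `|γ| > 14` (tree `riemannZeta_ne_zero_of_im_pos_of_im_le_fourteen`), so
  `zerosUpTo T = ∅` for `T ≤ 14`; `ρ ↦ m(ρ)/γ²` is summable (tree
  `LittlewoodAverage.summable_zeroOrder_div_im_sq`);
* the splitting `Z(a) = ∑_{|γ| ≤ T} + tail`, the tail bound
  `tail ≤ (∑|a_k|)² · 0.34 log T / T` (`T ≥ 2516`, tree `tailInvImSq_le`, `Gtail_le`);
* the low range: if `‖D(γ)‖ ≤ α + β|γ|` on `|γ| ≤ X` then
  `∑_{|γ| ≤ X} m γ^{-2} ‖D(γ)‖² ≤ 2α² ∑'_ρ m/γ² + 4β² N(X)`.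

The middle range (Gallagher cells + local zero density + mean values) is part II.
Nothing here bears on the truth of RH.
-/

noncomputable section

open Complex MeasureTheory Set Filter Finset intervalIntegral
open scoped Real Topology ComplexConjugate

set_option linter.dupNamespace false  -- the mandated namespace repeats `RiemannHypothesis`

namespace Summit.RiemannHypothesis.RiemannHypothesis.Theorems.EtaLeadingQuarter.ZeroSide

open Literature.NumberTheory.LFunctions NicolasJExplicit SchoenfeldBound ZetaZeroTails

/-! ## Real Dirichlet polynomials -/

/-- `D_a(t) = ∑_{k=1}^{M} a_k k^{-it}` for real coefficients `a`. [folklore] -/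
def dirPoly (a : ℕ → ℝ) (M : ℕ) (t : ℝ) : ℂ :=
  ∑ k ∈ Finset.Icc 1 M, ((a k : ℝ) : ℂ) * (k : ℂ) ^ (-((t : ℂ) * I))

/-- The `t`-derivative `D_a'(t) = ∑ a_k (−i log k) k^{-it}`. [folklore] -/
def dirPolyDeriv (a : ℕ → ℝ) (M : ℕ) (t : ℝ) : ℂ :=
  ∑ k ∈ Finset.Icc 1 M, ((a k : ℝ) : ℂ) * (-((Real.log k : ℝ) : ℂ) * I) * (k : ℂ) ^ (-((t : ℂ) * I))

/-- `D_a` has derivative `D_a'` (tree `hasDerivAt_dirichletPoly`). [folklore] -/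
theorem hasDerivAt_dirPoly (a : ℕ → ℝ) (M : ℕ) (t : ℝ) :
    HasDerivAt (dirPoly a M) (dirPolyDeriv a M t) t :=
  hasDerivAt_dirichletPoly (fun k ↦ ((a k : ℝ) : ℂ)) M t

/-- `D_a` is continuous. [folklore] -/
theorem continuous_dirPoly (a : ℕ → ℝ) (M : ℕ) : Continuous (dirPoly a M) :=
  continuous_iff_continuousAt.2 fun t ↦ (hasDerivAt_dirPoly a M t).continuousAt

/-- `D_a'` is continuous (it is again a Dirichlet polynomial). [folklore] -/
theorem continuous_dirPolyDeriv (a : ℕ → ℝ) (M : ℕ) : Continuous (dirPolyDeriv a M) := by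
  unfold dirPolyDeriv
  refine continuous_finsetSum _ fun k hk ↦ ?_
  rw [Finset.mem_Icc] at hk
  exact continuous_const.mul (continuous_natCast_cpow_neg_mul_I (by omega))

/-- The trivial bound `‖D_a(t)‖ ≤ ∑ |a_k|`. [folklore] -/
theorem norm_dirPoly_le (a : ℕ → ℝ) (M : ℕ) (t : ℝ) :
    ‖dirPoly a M t‖ ≤ ∑ k ∈ Finset.Icc 1 M, |a k| := by
  unfold dirPoly
  refine (norm_sum_le _ _).trans (Finset.sum_le_sum fun k hk ↦ ?_)
  rw [Finset.mem_Icc] at hk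
  rw [norm_mul, Literature.NumberTheory.Sieve.MatomakiRadziwillL11.norm_cpow_neg_mul_I (by omega), mul_one,
    Complex.norm_real, Real.norm_eq_abs]

/-- `D_a(−t) = conj D_a(t)` (real coefficients). [folklore] -/
theorem dirPoly_neg (a : ℕ → ℝ) (M : ℕ) (t : ℝ) : dirPoly a M (-t) = conj (dirPoly a M t) := by
  unfold dirPoly
  rw [map_sum]
  refine Finset.sum_congr rfl fun k hk ↦ ?_
  rw [Finset.mem_Icc] at hk
  have hk0 : k ≠ 0 := by omega
  rw [map_mul, Complex.conj_ofReal, Gallagher.natCast_cpow_eq_phase hk0,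
    Gallagher.natCast_cpow_eq_phase hk0, Gallagher.phase, Gallagher.phase, ← Complex.exp_conj,
    map_mul, Complex.conj_ofReal, Complex.conj_I]
  congr 1
  push_cast
  ring

/-- `‖D_a(−t)‖ = ‖D_a(t)‖`. [folklore] -/
theorem norm_dirPoly_neg (a : ℕ → ℝ) (M : ℕ) (t : ℝ) : ‖dirPoly a M (-t)‖ = ‖dirPoly a M t‖ := by
  rw [dirPoly_neg, Complex.norm_conj]

/-! ## All zeros have `|γ| > 14` -/

/-- Every non-trivial zero has `|Im ρ| > 14` (tree: `N(14) = 0`, certified). [folklore] -/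
theorem fourteen_lt_abs_im (ρ : Zeros) : 14 < |(ρ : ℂ).im| := by
  by_contra h
  rw [not_lt] at h
  have hz : riemannZeta (ρ : ℂ) = 0 := ZetaZeros.riemannZetaNontrivialZeros.zeta_eq_zero ρ.2
  have hne : (ρ : ℂ).im ≠ 0 := ZetaZeros.riemannZetaNontrivialZeros.im_ne_zero ρ.2
  rcases lt_or_gt_of_ne hne with hneg | hpos
  · -- conjugate zero in the upper half plane
    have hz' : riemannZeta (conj (ρ : ℂ)) = 0 :=
      ZetaZeros.riemannZetaNontrivialZeros.zeta_eq_zero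
        (ZetaZeros.riemannZetaNontrivialZeros.conj_mem ρ.2)
    refine riemannZeta_ne_zero_of_im_pos_of_im_le_fourteen (s := conj (ρ : ℂ)) ?_ ?_ hz'
    · rw [Complex.conj_im]; linarith
    · rw [Complex.conj_im, abs_of_neg hneg] at *; linarith
  · refine riemannZeta_ne_zero_of_im_pos_of_im_le_fourteen hpos ?_ hz
    rw [abs_of_pos hpos] at h; exact h

/-- `zerosUpTo T = ∅` for `T ≤ 14`. [folklore] -/
theorem zerosUpTo_eq_empty {T : ℝ} (hT : T ≤ 14) : zerosUpTo T = ∅ := by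
  ext ρ
  simp only [mem_zerosUpTo, Finset.notMem_empty, iff_false, not_le]
  exact hT.trans_lt (fourteen_lt_abs_im ρ)

/-- `0 ≤ m(ρ)/γ²`. [folklore] -/
theorem zeroOrder_div_im_sq_nonneg (ρ : Zeros) :
    0 ≤ (riemannZetaZeroOrder (ρ : ℂ) : ℝ) / (ρ : ℂ).im ^ 2 :=
  div_nonneg (zeroOrder_nonneg' ρ) (sq_nonneg _)

/-! ## The zero-side functional: summability, splitting, tail -/

/-- The summand `m(ρ) γ^{-2} ‖D_a(γ)‖²` is dominated by `(∑|a_k|)² · m(ρ)/γ²`. [folklore] -/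
theorem term_le (a : ℕ → ℝ) (M : ℕ) (ρ : Zeros) :
    (riemannZetaZeroOrder (ρ : ℂ) : ℝ) / (ρ : ℂ).im ^ 2 * ‖dirPoly a M (ρ : ℂ).im‖ ^ 2 ≤
      (∑ k ∈ Finset.Icc 1 M, |a k|) ^ 2 * ((riemannZetaZeroOrder (ρ : ℂ) : ℝ) / (ρ : ℂ).im ^ 2) := by
  rw [mul_comm]
  refine mul_le_mul_of_nonneg_right ?_ (zeroOrder_div_im_sq_nonneg ρ)
  exact pow_le_pow_left₀ (norm_nonneg _) (norm_dirPoly_le a M _) 2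

/-- Summability of `ρ ↦ m(ρ) γ^{-2} ‖D_a(γ)‖²`. [folklore] -/
theorem summable_term (a : ℕ → ℝ) (M : ℕ) :
    Summable fun ρ : Zeros ↦
      (riemannZetaZeroOrder (ρ : ℂ) : ℝ) / (ρ : ℂ).im ^ 2 * ‖dirPoly a M (ρ : ℂ).im‖ ^ 2 :=
  Summable.of_nonneg_of_le (fun ρ ↦ mul_nonneg (zeroOrder_div_im_sq_nonneg ρ) (sq_nonneg _))
    (term_le a M) (LittlewoodAverage.summable_zeroOrder_div_im_sq.mul_left _)

/-- **Splitting off the tail**: for any height `T`,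
`∑'_ρ m γ^{-2}‖D(γ)‖² = ∑_{|γ| ≤ T} m γ^{-2}‖D(γ)‖² + ∑'_ρ 1_{|γ| > T} m γ^{-2}‖D(γ)‖²`. [folklore] -/
theorem tsum_eq_sum_add_tail (a : ℕ → ℝ) (M : ℕ) (T : ℝ) :
    ∑' ρ : Zeros, (riemannZetaZeroOrder (ρ : ℂ) : ℝ) / (ρ : ℂ).im ^ 2 * ‖dirPoly a M (ρ : ℂ).im‖ ^ 2 =
      ∑ ρ ∈ zerosUpTo T, (riemannZetaZeroOrder (ρ : ℂ) : ℝ) / (ρ : ℂ).im ^ 2 * ‖dirPoly a M (ρ : ℂ).im‖ ^ 2 +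
      ∑' ρ : Zeros, (if ρ ∈ zerosUpTo T then 0 else
        (riemannZetaZeroOrder (ρ : ℂ) : ℝ) / (ρ : ℂ).im ^ 2 * ‖dirPoly a M (ρ : ℂ).im‖ ^ 2) := by
  classical
  set f : Zeros → ℝ := fun ρ ↦
    (riemannZetaZeroOrder (ρ : ℂ) : ℝ) / (ρ : ℂ).im ^ 2 * ‖dirPoly a M (ρ : ℂ).im‖ ^ 2 with hf
  have hs := summable_term a M
  have h1 : ∀ ρ, f ρ = (if ρ ∈ zerosUpTo T then f ρ else 0) + (if ρ ∈ zerosUpTo T then 0 else f ρ) := by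
    intro ρ; split_ifs <;> simp
  have hs1 : Summable fun ρ ↦ (if ρ ∈ zerosUpTo T then f ρ else 0) :=
    summable_of_ne_finset_zero (s := zerosUpTo T) fun ρ hρ ↦ if_neg hρ
  have hs2 : Summable fun ρ ↦ (if ρ ∈ zerosUpTo T then 0 else f ρ) := by
    refine Summable.of_nonneg_of_le (fun ρ ↦ ?_) (fun ρ ↦ ?_) hs
    · split_ifs
      · exact le_rfl
      · exact mul_nonneg (zeroOrder_div_im_sq_nonneg ρ) (sq_nonneg _)
    · split_ifs
      · exact mul_nonneg (zeroOrder_div_im_sq_nonneg ρ) (sq_nonneg _)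
      · exact le_rfl
  calc ∑' ρ, f ρ = ∑' ρ, ((if ρ ∈ zerosUpTo T then f ρ else 0) + (if ρ ∈ zerosUpTo T then 0 else f ρ)) :=
        tsum_congr h1
    _ = ∑' ρ, (if ρ ∈ zerosUpTo T then f ρ else 0) + ∑' ρ, (if ρ ∈ zerosUpTo T then 0 else f ρ) :=
        hs1.tsum_add hs2
    _ = _ := by rw [tsum_eq_sum (s := zerosUpTo T) (fun ρ hρ ↦ if_neg hρ), Finset.sum_ite_mem,
          Finset.inter_self]

/-- **Tail bound**: for `T ≥ 2516`,
`∑'_ρ 1_{|γ| > T} m γ^{-2}‖D(γ)‖² ≤ (∑|a_k|)² · (0.34 log T / T)`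
(tree: `ZetaZeroTails.tailInvImSq_le`, `Gtail_le`). [folklore] -/
theorem tail_le (a : ℕ → ℝ) (M : ℕ) {T : ℝ} (hT : 2516 ≤ T) :
    ∑' ρ : Zeros, (if ρ ∈ zerosUpTo T then 0 else
        (riemannZetaZeroOrder (ρ : ℂ) : ℝ) / (ρ : ℂ).im ^ 2 * ‖dirPoly a M (ρ : ℂ).im‖ ^ 2) ≤
      (∑ k ∈ Finset.Icc 1 M, |a k|) ^ 2 * (0.34 * Real.log T / T) := by
  classical
  set S : ℝ := (∑ k ∈ Finset.Icc 1 M, |a k|) ^ 2 with hS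
  have hT1 : (1 : ℝ) ≤ T := by linarith
  have htail := (tailInvImSq_le hT).trans (mul_le_mul_of_nonneg_left (Gtail_le hT) (by norm_num))
  have hs := summable_tailInvImSq hT1
  calc ∑' ρ : Zeros, (if ρ ∈ zerosUpTo T then 0 else
        (riemannZetaZeroOrder (ρ : ℂ) : ℝ) / (ρ : ℂ).im ^ 2 * ‖dirPoly a M (ρ : ℂ).im‖ ^ 2)
      ≤ ∑' ρ : Zeros, S * (if ρ ∈ zerosUpTo T then 0 else
          (riemannZetaZeroOrder (ρ : ℂ) : ℝ) / (ρ : ℂ).im ^ 2) := by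
        refine Summable.tsum_le_tsum (fun ρ ↦ ?_) ?_ (hs.mul_left S)
        · split_ifs
          · simp
          · exact term_le a M ρ
        · refine Summable.of_nonneg_of_le (fun ρ ↦ ?_) (fun ρ ↦ ?_) (hs.mul_left S)
          · split_ifs
            · exact le_rfl
            · exact mul_nonneg (zeroOrder_div_im_sq_nonneg ρ) (sq_nonneg _)
          · split_ifs
            · simp
            · exact term_le a M ρ
    _ = S * tailInvImSq T := by rw [tsum_mul_left]; rfl
    _ ≤ S * (2 * (0.17 * Real.log T / T)) := mul_le_mul_of_nonneg_left htail (sq_nonneg _)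
    _ = S * (0.34 * Real.log T / T) := by ring

/-! ## The low range -/

/-- `∑_{|Im ρ| ≤ X} m(ρ) = 2 N(X)` in the form `≤ 2 N(X)` (conjugation symmetry of the zeros,
tree `sum_sdiff_zerosUpTo_eq_two_mul`). [folklore] -/
theorem sum_zerosUpTo_order_le (X : ℝ) :
    ∑ ρ ∈ zerosUpTo X, (riemannZetaZeroOrder (ρ : ℂ) : ℝ) ≤ 2 * zetaZeroCount X := by
  classical
  rcases lt_or_ge X 0 with hX | hX
  · rw [zerosUpTo_eq_empty (by linarith)]
    simp
  have h := sum_sdiff_zerosUpTo_eq_two_mul (T₁ := 0) (T₂ := X) le_rfl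
    (g := fun z ↦ (riemannZetaZeroOrder z : ℝ)) (fun z ↦ by simp [riemannZetaZeroOrder_conj_holds z])
  rw [zerosUpTo_eq_empty (by norm_num : (0 : ℝ) ≤ 14), Finset.sdiff_empty] at h
  rw [h, ← zetaZeroCount_sub_eq_sum hX]
  have : (0 : ℝ) ≤ zetaZeroCount 0 := Nat.cast_nonneg _
  linarith

/-- **Low range.** If `‖D_a(γ)‖ ≤ α + β|γ|` for the zeros with `|γ| ≤ X`, then
`∑_{|γ| ≤ X} m γ^{-2} ‖D_a(γ)‖² ≤ 2α² ∑'_ρ m/γ² + 4β² N(X)`. [folklore] -/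
theorem lowRange_le (a : ℕ → ℝ) (M : ℕ) {X α β : ℝ}
    (hD : ∀ ρ ∈ zerosUpTo X, ‖dirPoly a M (ρ : ℂ).im‖ ≤ α + β * |(ρ : ℂ).im|) :
    ∑ ρ ∈ zerosUpTo X, (riemannZetaZeroOrder (ρ : ℂ) : ℝ) / (ρ : ℂ).im ^ 2 * ‖dirPoly a M (ρ : ℂ).im‖ ^ 2 ≤
      2 * α ^ 2 * (∑' ρ : Zeros, (riemannZetaZeroOrder (ρ : ℂ) : ℝ) / (ρ : ℂ).im ^ 2) +
        4 * β ^ 2 * zetaZeroCount X := by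
  have hpt : ∀ ρ ∈ zerosUpTo X,
      (riemannZetaZeroOrder (ρ : ℂ) : ℝ) / (ρ : ℂ).im ^ 2 * ‖dirPoly a M (ρ : ℂ).im‖ ^ 2 ≤
        2 * α ^ 2 * ((riemannZetaZeroOrder (ρ : ℂ) : ℝ) / (ρ : ℂ).im ^ 2) +
          2 * β ^ 2 * (riemannZetaZeroOrder (ρ : ℂ) : ℝ) := by
    intro ρ hρ
    have hγ0 : (ρ : ℂ).im ≠ 0 := ZetaZeros.riemannZetaNontrivialZeros.im_ne_zero ρ.2
    have h1 : ‖dirPoly a M (ρ : ℂ).im‖ ^ 2 ≤ 2 * α ^ 2 + 2 * β ^ 2 * (ρ : ℂ).im ^ 2 := by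
      have h := hD ρ hρ
      have hn := norm_nonneg (dirPoly a M (ρ : ℂ).im)
      calc ‖dirPoly a M (ρ : ℂ).im‖ ^ 2 ≤ (α + β * |(ρ : ℂ).im|) ^ 2 := pow_le_pow_left₀ hn h 2
        _ ≤ 2 * α ^ 2 + 2 * β ^ 2 * (ρ : ℂ).im ^ 2 := by
            rw [← sq_abs ((ρ : ℂ).im)]
            nlinarith [sq_nonneg (α - β * |(ρ : ℂ).im|)]
    calc (riemannZetaZeroOrder (ρ : ℂ) : ℝ) / (ρ : ℂ).im ^ 2 * ‖dirPoly a M (ρ : ℂ).im‖ ^ 2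
        ≤ (riemannZetaZeroOrder (ρ : ℂ) : ℝ) / (ρ : ℂ).im ^ 2 * (2 * α ^ 2 + 2 * β ^ 2 * (ρ : ℂ).im ^ 2) :=
          mul_le_mul_of_nonneg_left h1 (zeroOrder_div_im_sq_nonneg ρ)
      _ = _ := by field_simp
  refine (Finset.sum_le_sum hpt).trans ?_
  rw [Finset.sum_add_distrib, ← Finset.mul_sum, ← Finset.mul_sum]
  have h2 : ∑ ρ ∈ zerosUpTo X, (riemannZetaZeroOrder (ρ : ℂ) : ℝ) / (ρ : ℂ).im ^ 2 ≤
      ∑' ρ : Zeros, (riemannZetaZeroOrder (ρ : ℂ) : ℝ) / (ρ : ℂ).im ^ 2 :=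
    LittlewoodAverage.summable_zeroOrder_div_im_sq.sum_le_tsum _ fun ρ _ ↦ zeroOrder_div_im_sq_nonneg ρ
  have h3 := sum_zerosUpTo_order_le X
  nlinarith [sq_nonneg α, sq_nonneg β]

end Summit.RiemannHypothesis.RiemannHypothesis.Theorems.EtaLeadingQuarter.ZeroSide

end
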